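import Literature.AlgebraicGeometry.AbelianSchemes.AbelianSchemeKOfL
import Literature.AlgebraicGeometry.AbelianSchemes.LevelStructureTwist
import Literature.AlgebraicGeometry.Morphisms.FiniteEtaleSubschemeOfSplit
import HarnessLib

/-!
# `K(L)` over a base carrying a level structure: a finite, fibrewise-injective subgroup of sections (connected base)

Layer `Literature/AlgebraicGeometry/AbelianSchemes`, namespace `Literature.AlgebraicGeometry.AbelianSchemes.AbelianSchemeOver`.
THEOREMS ONLY (no definition, no named fact, no instance, no notation, no `sorry`).  Cell `hodgecm-mathlib` (D-0151),
FLOOR-0 programme P1, F-3 child line (M) `Cruxes/HDel/Lines/F3DualAbelianSchemeM`, letter (Ma) «split the finite étale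
`K(L)` over the level-`m`-basis cover» (B-typ04 (g15) letters d823bfca §2; B-plan1 (g19) (M)-card v1, GO 19:19:19Z,
freeness add-on 19:29:45Z (2)): the CONNECTED-BASE core of that letter, in its own currency.  Author B-p19 (g18);
count-neutral capital.  HC_CM is proved only modulo the 7 printed citations until rung 0 closes; nothing here is about HC.

## Statement ([MumfordAV1970] §13 «`K(L)` … a finite group scheme», made étale-local as in [MumfordFogartyKirwan1994]
Ch. 7 §2 Prop. 7.3 step (IV): over the scheme of level-`n` bases `X[n]` is the constant group `(ℤ/n)^{2g}`)

Let `A → S` be an abelian scheme with commutative group law over a PRECONNECTED base `S` carrying a level-`M` structure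
`φ` (so the finite étale `A[M] → S` is SPLIT by the `M^{2g}` sections `σ^a = Σ aᵢ φᵢ`), let `L` be a rank-one module on `A`
rigidified along the unit section (`ε^*[L] = 1`), and suppose `K(L)` is represented by a closed `Z ↪ A` that is étale over
`S` (the F-3 (K) output) and is `M`-torsion (`K(L) ⊆ A[M]`, the exponent input).  Then the group `K′ := K(L)(S)` of ALL
sections of `A` lying in `K(L)` (★ `AbelianSchemeOver.kOfL L hL hε (𝟙_ (Over S))`) is

* FINITE (every member is one of the `σ^a`: ★ `Morphisms.exists_comp_eq_section_of_preconnectedSpace`),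
* INJECTIVE ON EVERY GEOMETRIC FIBRE (distinct members restrict to distinct points of `A_s̄(Ω)` — the freeness input of
  (Mb): the translation action of `K′` is free; from `LevelStructure.basis_injective`), and
* `K(L) = ` the CONSTANT subgroup scheme on `K′`: a `T`-point `u` of `A` lies in `K(L)` iff, locally on `T`, it is the
  restriction of a member of `K′` — the membership clause of letter (Ma) VERBATIM in shape
  (`∃ 𝒱 : OpenCover T.left, ∀ j, ∃ σ : K′, 𝒱.f j ≫ u.left = 𝒱.f j ≫ T.hom ≫ σ.left`; ⇒ by ★
  `Morphisms.exists_fac_iff_exists_openCover_of_split`, ⇐ by gluing the local factorisations through the monomorphism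
  `Z ↪ A`, Mathlib `Scheme.Cover.glueMorphisms`).

Further, for the DISCONNECTED level-basis torsor `S′` of letter (Ma0) (B-plan1 (g19) ruling r-conn 19:36Z: `Spec R` connected,
`K′` glued across the components of `S′` = repair (r2)):

* `finite_kOfL_and_injective_and_memKOfL_iff_of_levelStructure_on_opens` — the same three conclusions RELATIVE to a
  preconnected OPEN `U ⊆ S` (no connectedness of `S`), for `K′_U := A.kOfL L hL hε (Over.mk U.ι)` and `T`-points over `U`;
* the GLUING across the pieces of a clopen partition (disconnected base) is in the sequel file
  `AbelianSchemes/AbelianSchemeKOfLConstantSectionsGlue.lean`.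

`A[M]` enters only through its three defining clauses (binders `incl`, `hpow`, `hlift`, `hinj` = the conclusion of ★
`LevelBasisFiniteEtaleCover.exists_torsion_subscheme`, not imported here to stay below the `PolarizedAbelianSchemeWithLevel`
cone).  The (Ma) prover applies this on the connected components of the level-basis cover `S′ → Spec R` of (Ma0) (or on
`S′` itself when it is chosen connected), with `A := A ×_R S′`.  WITNESS for the connectedness hypothesis (B-p19 (g18),
cell bus 2026-08-30 19:34Z; folded into the (M) letters ed. 4 as `[ConnectedSpace (Spec (.of R))]`, B-plan1 (g19) ruling
r-conn 19:36Z): over `Spec (ℚ × ℚ)` take `A := E ⊔ E` (an elliptic curve on each component) and `L := 𝒪(0) ⊔ 𝒪(3·0)`, so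
`K(L) = 1 ⊔ E[3]` has degrees `1` and `9` on the two components; a subgroup of sections that is injective on the fibres over
the first component is trivial, hence cannot exhaust `E[3]` over the second — finiteness + fibrewise injectivity +
exhaustion force `#K′ = #K(L_s̄)` for every geometric point `s̄`, i.e. a constant degree, i.e. (for one `K′`) a connected base.

## References
* [MumfordAV1970] D. Mumford, *Abelian Varieties* (1970), §13 (p. 123) and §7 Thm. 4 (p. 72).
* [MumfordFogartyKirwan1994] D. Mumford, J. Fogarty, F. Kirwan, *Geometric Invariant Theory*, 3rd ed. (1994), Ch. 7 §2
  Definition 7.1 (p. 129), Proposition 7.3, proof, step (IV) (pp. 133–134); App. 7B (p. 240).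
* [GortzWedhorn2023] U. Görtz, T. Wedhorn, *Algebraic Geometry II* (2023), Prop. 27.188 (1) (p. 675).
* [GortzWedhorn2020] U. Görtz, T. Wedhorn, *Algebraic Geometry I*, 2nd ed. (2020), Prop. 3.5 (gluing of morphisms),
  Def./Prop. 9.7.
-/

noncomputable section

universe u

open CategoryTheory CategoryTheory.Limits AlgebraicGeometry MonoidalCategory CartesianMonoidalCategory

open scoped MonObj Obj

namespace Literature.AlgebraicGeometry.AbelianSchemes

open Literature.AlgebraicGeometry.Modules Literature.AlgebraicGeometry.Motives Literature.AlgebraicGeometry.AbelianVarieties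
  Literature.AlgebraicGeometry.Morphisms

namespace AbelianSchemeOver

variable {S : Scheme.{u}} (A : AbelianSchemeOver S)

/-- Sections of `A → S` over an EMPTY base form a subsingleton (the empty scheme is initial). [cite: GortzWedhorn2020, Prop. 3.5] -/
theorem subsingleton_sections_of_isEmpty [IsEmpty S] : Subsingleton A.Sections := by
  refine ⟨fun _ _ => Over.OverMorphism.ext ?_⟩
  haveI : IsEmpty ↥((𝟙_ (Over S)).left) := ‹IsEmpty S›
  exact (isInitialOfIsEmpty (X := (𝟙_ (Over S)).left)).hom_ext _ _

/-- **`K(L)(S)` over a connected base with a level structure: finite, fibrewise injective, and `K(L)` is the constant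
subgroup scheme on it.**  Hypotheses: `A → S` an abelian scheme with commutative group law over a preconnected `S`;
`L` of rank one with `ε^*[L] = 1`; `φ` a level-`M` structure (`M ≠ 0`); `A[M]` given by its three defining clauses
(`incl : A_M → A` finite étale over `S` with `(w ≫ incl)^M = 1`, every `M`-torsion point factors through `incl`, uniquely);
`K(L)` represented by `i : Z → A`, a closed immersion with `Z → S` étale (`hZ`); and `K(L) ⊆ A[M]` on points (`hKM`).
Conclusions for `K′ := A.kOfL L hL hε (𝟙_ (Over S))`: (1) `Finite K′`; (2) for every geometric point `s : Spec Ω → S`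
(`Ω` algebraically closed) the restriction `K′ → A_s(Ω)` is injective; (3) for every `T ∈ Over S` and `u : T → A`:
`u ∈ K(L)(T)` iff there is an open cover of `T` on each member of which `u` is the restriction of a member of `K′`.
[MumfordAV1970] §13: over the level-`n`-basis cover, `K(L)` is a finite CONSTANT group of sections — the form Mumford's
quotient `A⁄K(L)` (★ `quotientBy`) consumes. [cite: MumfordAV1970, §13 (p. 123)]
[cite: MumfordFogartyKirwan1994, Ch. 7 §2 Proposition 7.3, proof step (IV) (pp. 133–134)]
[cite: GortzWedhorn2023, Prop. 27.188 (1) (p. 675)] -/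
theorem finite_kOfL_and_injective_restrict_and_memKOfL_iff_of_levelStructure [IsCommMonObj A.X] [PreconnectedSpace S]
    (L : A.left.Modules) (hL : HasRank L 1)
    (hε : CechPic.pullback A.unitSection (detClass (HasRank.isFiniteLocallyFree' hL)) = 1)
    {g M : ℕ} [NeZero M] (φ : LevelStructure g M A)
    {AM : Over S} (incl : AM ⟶ A.X) [IsFinite AM.hom] [Etale AM.hom]
    (hpow : ∀ (Y : Over S) (w : Y ⟶ AM), (w ≫ incl) ^ M = 1)
    (hlift : ∀ (Y : Over S) (z : Y ⟶ A.X), z ^ M = 1 → ∃ w : Y ⟶ AM, w ≫ incl = z)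
    (hinj : ∀ (Y : Over S) (w w' : Y ⟶ AM), w ≫ incl = w' ≫ incl → w = w')
    {Z : Over S} (i : Z ⟶ A.X) [IsClosedImmersion i.left] [Etale Z.hom]
    (hZ : ∀ (T : Over S) (u : T ⟶ A.X), (∃ v : T ⟶ Z, v ≫ i = u) ↔ A.MemKOfL L u)
    (hKM : ∀ (T : Over S) (u : T ⟶ A.X), A.MemKOfL L u → u ^ M = 1) :
    Finite (A.kOfL L hL hε (𝟙_ (Over S))) ∧
    (∀ ⦃Ω : Type u⦄ [Field Ω] [IsAlgClosed Ω] (s : Spec (.of Ω) ⟶ S),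
      Function.Injective fun σ : A.kOfL L hL hε (𝟙_ (Over S)) => A.restrict s (σ : A.Sections)) ∧
    ∀ (T : Over S) (u : T ⟶ A.X), A.MemKOfL L u ↔
      ∃ 𝒱 : Scheme.OpenCover.{u} T.left, ∀ j, ∃ σ : A.kOfL L hL hε (𝟙_ (Over S)),
        𝒱.f j ≫ u.left = 𝒱.f j ≫ T.hom ≫ (σ : A.Sections).left := by
  classical
  -- (0) the splitting sections of `A[M]`: `w a : 𝟙_ ⟶ A_M` lifting `σ^a`
  have hsM : ∀ a : Fin g ⊕ Fin g → ZMod M, A.sectionPow φ.σ a ^ M = 1 := fun a => A.sectionPow_pow_eq_one φ.pow_σ a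
  choose w hw using fun a => hlift (𝟙_ (Over S)) (A.sectionPow φ.σ a) (hsM a)
  have hφq : ∀ a, (w a).left ≫ AM.hom = 𝟙 S := fun a => Over.w (w a)
  -- every geometric point of `A[M]` is a value of some `w a` (the level structure is a basis on geometric fibres)
  have hsplit : ∀ ⦃Ω : Type u⦄ [Field Ω] [IsAlgClosed Ω] (y : Spec (.of Ω) ⟶ AM.left),
      ∃ a, y = (y ≫ AM.hom) ≫ (w a).left := by
    intro Ω _ _ y
    let yo : Over.mk (y ≫ AM.hom) ⟶ AM := Over.homMk y rfl
    obtain ⟨a, ha⟩ := φ.basis_surjective (y ≫ AM.hom) (yo ≫ incl) (hpow _ yo)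
    refine ⟨a, ?_⟩
    have h1 : toUnit (Over.mk (y ≫ AM.hom)) ≫ w a = yo :=
      hinj _ _ _ (by rw [Category.assoc, hw]; exact ha)
    have h2 : (toUnit (Over.mk (y ≫ AM.hom)) ≫ w a).left = yo.left := by rw [h1]
    rw [Over.comp_left, Over.toUnit_left] at h2
    change (y ≫ AM.hom) ≫ (w a).left = y at h2
    exact h2.symm
  -- (1) `Z ⊆ A[M]`: the inclusion `j : Z ⟶ A_M`, a closed immersion on total spaces
  have hiZ : A.MemKOfL L i := (hZ Z i).1 ⟨𝟙 Z, Category.id_comp _⟩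
  obtain ⟨j, hj⟩ := hlift Z i (hKM Z i hiZ)
  haveI : IsSeparated incl.left := by
    have : IsSeparated (incl.left ≫ A.X.hom) := by rw [Over.w incl]; infer_instance
    exact IsSeparated.of_comp incl.left A.X.hom
  haveI : IsClosedImmersion j.left := by
    have : IsClosedImmersion (j.left ≫ incl.left) := by rw [← Over.comp_left, hj]; infer_instance
    exact IsClosedImmersion.of_comp j.left incl.left
  have hjq : j.left ≫ AM.hom = Z.hom := Over.w j
  -- (2) the sections `σ^a` whose lift factors through `Z` lie in `K(L)(S)`
  have hmemK : ∀ a, (∃ ψ : S ⟶ Z.left, ψ ≫ j.left = (w a).left) →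
      A.sectionPow φ.σ a ∈ A.kOfL L hL hε (𝟙_ (Over S)) := by
    rintro a ⟨ψ, hψ⟩
    rw [A.mem_kOfL_iff, ← hZ]
    let ψ' : (𝟙_ (Over S)).left ⟶ Z.left := ψ
    have hψ' : ψ' ≫ j.left = (w a).left := hψ
    have hψS : ψ' ≫ Z.hom = (𝟙_ (Over S)).hom := by
      rw [← hjq, ← Category.assoc, hψ']; exact Over.w (w a)
    refine ⟨Over.homMk ψ' hψS, ?_⟩
    rw [← hw a, ← hj, ← Category.assoc]
    congr 1
    exact Over.OverMorphism.ext (by change ψ' ≫ j.left = (w a).left; exact hψ')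
  -- (3) conversely every member of `K(L)(S)` is some `σ^a` (nonempty preconnected base)
  have hexists : Nonempty S → ∀ σ : A.Sections, σ ∈ A.kOfL L hL hε (𝟙_ (Over S)) →
      ∃ a : Fin g ⊕ Fin g → ZMod M, σ = A.sectionPow φ.σ a := by
    intro hne σ hσ
    haveI := hne
    obtain ⟨wσ, hwσ⟩ := hlift _ σ (hKM _ σ ((A.mem_kOfL_iff hL hε σ).1 hσ))
    haveI : Nonempty ↥((𝟙_ (Over S)).left) := hne
    haveI : PreconnectedSpace ↥((𝟙_ (Over S)).left) := ‹PreconnectedSpace S›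
    obtain ⟨a, ha⟩ := exists_comp_eq_section_of_preconnectedSpace AM.hom (fun a => (w a).left) hφq hsplit
      wσ.left (𝟙_ (Over S)).hom (Over.w wσ)
    refine ⟨a, ?_⟩
    rw [← hwσ, ← hw a]
    congr 1
    exact Over.OverMorphism.ext (ha.trans (Category.id_comp _))
  refine ⟨?_, ?_, fun T u => ⟨fun hu => ?_, fun h => ?_⟩⟩
  · -- (1) finiteness
    rcases isEmpty_or_nonempty S with hS | hS
    · haveI := A.subsingleton_sections_of_isEmpty
      infer_instance
    · have hfin : (Set.range fun a : Fin g ⊕ Fin g → ZMod M => A.sectionPow φ.σ a).Finite := Set.finite_range _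
      have hsub : ((A.kOfL L hL hε (𝟙_ (Over S)) : Subgroup A.Sections) : Set A.Sections) ⊆
          Set.range fun a : Fin g ⊕ Fin g → ZMod M => A.sectionPow φ.σ a := by
        intro σ hσ
        obtain ⟨a, ha⟩ := hexists hS σ hσ
        exact ⟨a, ha.symm⟩
      exact (hfin.subset hsub).to_subtype
  · -- (2) injectivity on geometric fibres
    intro Ω _ _ s σ τ hστ
    have hS : Nonempty S := ⟨s.base (IsLocalRing.closedPoint Ω)⟩
    obtain ⟨a, ha⟩ := hexists hS σ.1 σ.2
    obtain ⟨b, hb⟩ := hexists hS τ.1 τ.2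
    apply Subtype.ext
    change A.restrict s σ.1 = A.restrict s τ.1 at hστ
    rw [ha, hb] at hστ ⊢
    rw [φ.basis_injective s hστ]
  · -- (3, ⇒) `u ∈ K(L)(T)`: factor through `Z ⊆ A[M]` and read the split form locally
    obtain ⟨v, hv⟩ := (hZ T u).2 hu
    have hx : (v.left ≫ j.left) ≫ AM.hom = T.hom := by rw [Category.assoc, hjq]; exact Over.w v
    obtain ⟨𝒱, h𝒱⟩ := (exists_fac_iff_exists_openCover_of_split j.left AM.hom (fun a => (w a).left) hφq hsplit hjq
      (v.left ≫ j.left) T.hom hx).1 ⟨v.left, rfl⟩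
    refine ⟨𝒱, fun k => ?_⟩
    obtain ⟨a, hψ, hk⟩ := h𝒱 k
    refine ⟨⟨A.sectionPow φ.σ a, hmemK a hψ⟩, ?_⟩
    change 𝒱.f k ≫ u.left = 𝒱.f k ≫ T.hom ≫ (A.sectionPow φ.σ a).left
    have e1 : u.left = v.left ≫ j.left ≫ incl.left := by rw [← hv, ← hj]; rfl
    have e2 : (A.sectionPow φ.σ a).left = (w a).left ≫ incl.left := by rw [← hw a]; rfl
    have hk' := congrArg (· ≫ incl.left) hk
    simp only [Category.assoc] at hk'
    rw [e1, e2]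
    exact hk'
  · -- (3, ⇐) locally `u` is the restriction of a member of `K(L)(S)`: glue the local factorisations through `Z`
    obtain ⟨𝒱, h𝒱⟩ := h
    choose σ hσ using h𝒱
    -- on each member, `u` restricted is in `K(L)`, hence factors through `Z`
    have hloc : ∀ k, ∃ vk : Over.mk (𝒱.f k ≫ T.hom) ⟶ Z, vk ≫ i = Over.homMk (𝒱.f k) rfl ≫ u := by
      intro k
      rw [hZ]
      have heq : Over.homMk (𝒱.f k) rfl ≫ u = toUnit (Over.mk (𝒱.f k ≫ T.hom)) ≫ ((σ k : A.Sections)) :=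
        Over.OverMorphism.ext (by
          change 𝒱.f k ≫ u.left = (𝒱.f k ≫ T.hom) ≫ (σ k : A.Sections).left
          rw [hσ k, Category.assoc])
      rw [heq]
      exact A.memKOfL_comp hL _ _ ((A.mem_kOfL_iff hL hε _).1 (σ k).2)
    choose vk hvk using hloc
    let vkL : ∀ k, 𝒱.X k ⟶ Z.left := fun k => (vk k).left
    have hvkL : ∀ k, vkL k ≫ i.left = 𝒱.f k ≫ u.left := fun k => by
      change (vk k ≫ i).left = _
      rw [hvk k]; rfl
    -- compatibility on overlaps: `i` is a monomorphism on total spaces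
    have hcompat : ∀ k k', pullback.fst (𝒱.f k) (𝒱.f k') ≫ vkL k = pullback.snd (𝒱.f k) (𝒱.f k') ≫ vkL k' := by
      intro k k'
      rw [← cancel_mono i.left, Category.assoc, Category.assoc, hvkL, hvkL, pullback.condition_assoc]
    let vL : T.left ⟶ Z.left := Scheme.Cover.glueMorphisms 𝒱 vkL hcompat
    have hvL : ∀ k, 𝒱.f k ≫ vL = vkL k := fun k => Scheme.Cover.ι_glueMorphisms 𝒱 _ hcompat k
    have hvLi : vL ≫ i.left = u.left :=
      Scheme.Cover.hom_ext 𝒱 _ _ fun k => by rw [← Category.assoc, hvL, hvkL]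
    have hvLS : vL ≫ Z.hom = T.hom := by
      rw [← Over.w i, ← Category.assoc, hvLi]; exact Over.w u
    exact (hZ T u).1 ⟨Over.homMk vL hvLS, Over.OverMorphism.ext (by change vL ≫ i.left = u.left; exact hvLi)⟩

/-- Morphisms `T ⟶ A` over `S` from an `S`-scheme with EMPTY total space form a subsingleton. [cite: GortzWedhorn2020, Prop. 3.5] -/
theorem subsingleton_hom_of_isEmpty (T : Over S) [IsEmpty T.left] : Subsingleton (T ⟶ A.X) :=
  ⟨fun _ _ => Over.OverMorphism.ext ((isInitialOfIsEmpty (X := T.left)).hom_ext _ _)⟩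

/-- **`K(L)(U)` on a preconnected OPEN `U ⊆ S` (no connectedness of `S`): finite, injective on the geometric fibres
over `U`, and `K(L)` restricted to `T`-points over `U` is the constant subgroup scheme on it** — the relative form of
`finite_kOfL_and_injective_restrict_and_memKOfL_iff_of_levelStructure`, with `K′_U := A.kOfL L hL hε (Over.mk U.ι)`
(a subgroup of the `U`-points `Over.mk U.ι ⟶ A` of `A`) and `T`-points `u : T ⟶ A` whose structure map factors as
`gU ≫ U.ι`.  Used on the (clopen) connected components `U` of the disconnected level-basis torsor `S′` of letter (Ma0),
where the level structure, `L`, `Z` and `A[M]` are GLOBAL on `S′`; no base change of `A` is formed.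
[cite: MumfordAV1970, §13 (p. 123)] [cite: MumfordFogartyKirwan1994, Ch. 7 §2 Proposition 7.3, proof step (IV) (pp. 133–134)]
[cite: GortzWedhorn2023, Prop. 27.188 (1) (p. 675)] -/
theorem finite_kOfL_and_injective_and_memKOfL_iff_of_levelStructure_on_opens [IsCommMonObj A.X]
    (L : A.left.Modules) (hL : HasRank L 1)
    (hε : CechPic.pullback A.unitSection (detClass (HasRank.isFiniteLocallyFree' hL)) = 1)
    {g M : ℕ} [NeZero M] (φ : LevelStructure g M A)
    {AM : Over S} (incl : AM ⟶ A.X) [IsFinite AM.hom] [Etale AM.hom]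
    (hpow : ∀ (Y : Over S) (w : Y ⟶ AM), (w ≫ incl) ^ M = 1)
    (hlift : ∀ (Y : Over S) (z : Y ⟶ A.X), z ^ M = 1 → ∃ w : Y ⟶ AM, w ≫ incl = z)
    (hinj : ∀ (Y : Over S) (w w' : Y ⟶ AM), w ≫ incl = w' ≫ incl → w = w')
    {Z : Over S} (i : Z ⟶ A.X) [IsClosedImmersion i.left] [Etale Z.hom]
    (hZ : ∀ (T : Over S) (u : T ⟶ A.X), (∃ v : T ⟶ Z, v ≫ i = u) ↔ A.MemKOfL L u)
    (hKM : ∀ (T : Over S) (u : T ⟶ A.X), A.MemKOfL L u → u ^ M = 1)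
    (U : S.Opens) [PreconnectedSpace U] :
    Finite (A.kOfL L hL hε (Over.mk U.ι)) ∧
    (∀ ⦃Ω : Type u⦄ [Field Ω] [IsAlgClosed Ω] (c : Spec (.of Ω) ⟶ (U : Scheme.{u})),
      Function.Injective fun σ : A.kOfL L hL hε (Over.mk U.ι) =>
        (Over.homMk c rfl : Over.mk (c ≫ U.ι) ⟶ Over.mk U.ι) ≫ (σ : Over.mk U.ι ⟶ A.X)) ∧
    ∀ (T : Over S) (u : T ⟶ A.X) (gU : T.left ⟶ U), gU ≫ U.ι = T.hom →
      (A.MemKOfL L u ↔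
        ∃ 𝒱 : Scheme.OpenCover.{u} T.left, ∀ j, ∃ σ : A.kOfL L hL hε (Over.mk U.ι),
          𝒱.f j ≫ u.left = 𝒱.f j ≫ gU ≫ (σ : Over.mk U.ι ⟶ A.X).left) := by
  classical
  -- (0) the splitting sections of `A[M]`: `w a : 𝟙_ ⟶ A_M` lifting `σ^a` (global on `S`)
  have hsM : ∀ a : Fin g ⊕ Fin g → ZMod M, A.sectionPow φ.σ a ^ M = 1 := fun a => A.sectionPow_pow_eq_one φ.pow_σ a
  choose w hw using fun a => hlift (𝟙_ (Over S)) (A.sectionPow φ.σ a) (hsM a)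
  have hφq : ∀ a, (w a).left ≫ AM.hom = 𝟙 S := fun a => Over.w (w a)
  have hsplit : ∀ ⦃Ω : Type u⦄ [Field Ω] [IsAlgClosed Ω] (y : Spec (.of Ω) ⟶ AM.left),
      ∃ a, y = (y ≫ AM.hom) ≫ (w a).left := by
    intro Ω _ _ y
    let yo : Over.mk (y ≫ AM.hom) ⟶ AM := Over.homMk y rfl
    obtain ⟨a, ha⟩ := φ.basis_surjective (y ≫ AM.hom) (yo ≫ incl) (hpow _ yo)
    refine ⟨a, ?_⟩
    have h1 : toUnit (Over.mk (y ≫ AM.hom)) ≫ w a = yo :=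
      hinj _ _ _ (by rw [Category.assoc, hw]; exact ha)
    have h2 : (toUnit (Over.mk (y ≫ AM.hom)) ≫ w a).left = yo.left := by rw [h1]
    rw [Over.comp_left, Over.toUnit_left] at h2
    change (y ≫ AM.hom) ≫ (w a).left = y at h2
    exact h2.symm
  -- the `U`-points `σU a := (σ^a)|_U`
  let tU : Over.mk U.ι ⟶ 𝟙_ (Over S) := toUnit (Over.mk U.ι)
  have htU : tU.left = U.ι := Over.toUnit_left
  -- (1) `Z ⊆ A[M]`
  have hiZ : A.MemKOfL L i := (hZ Z i).1 ⟨𝟙 Z, Category.id_comp _⟩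
  obtain ⟨j, hj⟩ := hlift Z i (hKM Z i hiZ)
  haveI : IsSeparated incl.left := by
    have : IsSeparated (incl.left ≫ A.X.hom) := by rw [Over.w incl]; infer_instance
    exact IsSeparated.of_comp incl.left A.X.hom
  haveI : IsClosedImmersion j.left := by
    have : IsClosedImmersion (j.left ≫ incl.left) := by rw [← Over.comp_left, hj]; infer_instance
    exact IsClosedImmersion.of_comp j.left incl.left
  have hjq : j.left ≫ AM.hom = Z.hom := Over.w j
  -- (2) `(σ^a)|_U ∈ K(L)(U)` as soon as its lift factors through `Z` over `U`
  have hmemK : ∀ a, (∃ ψ : (U : Scheme.{u}) ⟶ Z.left, ψ ≫ j.left = U.ι ≫ (w a).left) →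
      tU ≫ A.sectionPow φ.σ a ∈ A.kOfL L hL hε (Over.mk U.ι) := by
    rintro a ⟨ψ, hψ⟩
    rw [A.mem_kOfL_iff, ← hZ]
    let ψ' : (Over.mk U.ι).left ⟶ Z.left := ψ
    have hψ' : ψ' ≫ j.left = U.ι ≫ (w a).left := hψ
    have hψS : ψ' ≫ Z.hom = (Over.mk U.ι).hom := by
      rw [← hjq, ← Category.assoc, hψ']
      change (U.ι ≫ (w a).left) ≫ AM.hom = U.ι
      calc (U.ι ≫ (w a).left) ≫ AM.hom = U.ι ≫ ((w a).left ≫ AM.hom) := Category.assoc _ _ _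
        _ = U.ι ≫ 𝟙 S := congrArg (fun f : (𝟙_ (Over S)).left ⟶ S => U.ι ≫ f) (hφq a)
        _ = U.ι := Category.comp_id _
    refine ⟨Over.homMk ψ' hψS, ?_⟩
    rw [← hw a, ← hj, ← Category.assoc, ← Category.assoc]
    congr 1
    exact Over.OverMorphism.ext (by
      change ψ' ≫ j.left = tU.left ≫ (w a).left
      rw [htU]; exact hψ')
  -- (3) conversely every member of `K(L)(U)` is some `(σ^a)|_U` (nonempty preconnected `U`)
  have hexists : Nonempty U → ∀ σ : Over.mk U.ι ⟶ A.X, σ ∈ A.kOfL L hL hε (Over.mk U.ι) →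
      ∃ a : Fin g ⊕ Fin g → ZMod M, σ = tU ≫ A.sectionPow φ.σ a := by
    intro hne σ hσ
    haveI := hne
    obtain ⟨wσ, hwσ⟩ := hlift _ σ (hKM _ σ ((A.mem_kOfL_iff hL hε σ).1 hσ))
    haveI : Nonempty ↥((Over.mk U.ι).left) := hne
    haveI : PreconnectedSpace ↥((Over.mk U.ι).left) := ‹PreconnectedSpace U›
    obtain ⟨a, ha⟩ := exists_comp_eq_section_of_preconnectedSpace AM.hom (fun a => (w a).left) hφq hsplit
      wσ.left (Over.mk U.ι).hom (Over.w wσ)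
    refine ⟨a, ?_⟩
    rw [← hwσ, ← hw a, ← Category.assoc]
    congr 1
    exact Over.OverMorphism.ext (by
      change wσ.left = tU.left ≫ (w a).left
      rw [htU]; exact ha)
  refine ⟨?_, ?_, fun T u gU hT => ⟨fun hu => ?_, fun h => ?_⟩⟩
  · -- (1) finiteness
    rcases isEmpty_or_nonempty U with hU | hU
    · haveI : IsEmpty ↥((Over.mk U.ι).left) := hU
      haveI := A.subsingleton_hom_of_isEmpty (Over.mk U.ι)
      infer_instance
    · have hfin : (Set.range fun a : Fin g ⊕ Fin g → ZMod M => tU ≫ A.sectionPow φ.σ a).Finite :=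
        Set.finite_range _
      have hsub : ((A.kOfL L hL hε (Over.mk U.ι) : Subgroup (Over.mk U.ι ⟶ A.X)) : Set (Over.mk U.ι ⟶ A.X)) ⊆
          Set.range fun a : Fin g ⊕ Fin g → ZMod M => tU ≫ A.sectionPow φ.σ a := by
        intro σ hσ
        obtain ⟨a, ha⟩ := hexists hU σ hσ
        exact ⟨a, ha.symm⟩
      exact (hfin.subset hsub).to_subtype
  · -- (2) injectivity on the geometric fibres over `U`
    intro Ω _ _ c σ τ hστ
    have hU : Nonempty U := ⟨c.base (IsLocalRing.closedPoint Ω)⟩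
    obtain ⟨a, ha⟩ := hexists hU σ.1 σ.2
    obtain ⟨b, hb⟩ := hexists hU τ.1 τ.2
    apply Subtype.ext
    change (Over.homMk c rfl : Over.mk (c ≫ U.ι) ⟶ Over.mk U.ι) ≫ σ.1 =
      (Over.homMk c rfl : Over.mk (c ≫ U.ι) ⟶ Over.mk U.ι) ≫ τ.1 at hστ
    have htc : (Over.homMk c rfl : Over.mk (c ≫ U.ι) ⟶ Over.mk U.ι) ≫ tU = toUnit (Over.mk (c ≫ U.ι)) :=
      Subsingleton.elim _ _
    rw [ha, hb, ← Category.assoc, ← Category.assoc, htc] at hστ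
    rw [ha, hb, φ.basis_injective (c ≫ U.ι) hστ]
  · -- (3, ⇒)
    obtain ⟨v, hv⟩ := (hZ T u).2 hu
    have hx : (v.left ≫ j.left) ≫ AM.hom = gU ≫ U.ι := by rw [Category.assoc, hjq, hT]; exact Over.w v
    obtain ⟨𝒱, h𝒱⟩ := (exists_fac_iff_exists_openCover_of_split_on_opens j.left AM.hom (fun a => (w a).left) hφq
      hsplit hjq U (v.left ≫ j.left) gU hx).1 ⟨v.left, rfl⟩
    refine ⟨𝒱, fun k => ?_⟩
    obtain ⟨a, hψ, hk⟩ := h𝒱 k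
    refine ⟨⟨tU ≫ A.sectionPow φ.σ a, hmemK a hψ⟩, ?_⟩
    change 𝒱.f k ≫ u.left = 𝒱.f k ≫ gU ≫ (tU ≫ A.sectionPow φ.σ a).left
    have e1 : u.left = v.left ≫ j.left ≫ incl.left := by rw [← hv, ← hj]; rfl
    have e2 : (tU ≫ A.sectionPow φ.σ a).left = U.ι ≫ (w a).left ≫ incl.left := by
      rw [← hw a, Over.comp_left, Over.comp_left, htU]; rfl
    have hk' := congrArg (· ≫ incl.left) hk
    simp only [Category.assoc] at hk'
    rw [e1, e2]
    exact hk'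
  · -- (3, ⇐) glue the local factorisations through the monomorphism `Z ↪ A`
    obtain ⟨𝒱, h𝒱⟩ := h
    choose σ hσ using h𝒱
    have hloc : ∀ k, ∃ vk : Over.mk (𝒱.f k ≫ T.hom) ⟶ Z, vk ≫ i = Over.homMk (𝒱.f k) rfl ≫ u := by
      intro k
      rw [hZ]
      have hgk : (𝒱.f k ≫ gU) ≫ (Over.mk U.ι).hom = (Over.mk (𝒱.f k ≫ T.hom)).hom := by
        change (𝒱.f k ≫ gU) ≫ U.ι = 𝒱.f k ≫ T.hom
        rw [Category.assoc, hT]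
      have heq : Over.homMk (𝒱.f k) rfl ≫ u =
          (Over.homMk (𝒱.f k ≫ gU) hgk : Over.mk (𝒱.f k ≫ T.hom) ⟶ Over.mk U.ι) ≫
            (σ k : Over.mk U.ι ⟶ A.X) :=
        Over.OverMorphism.ext (by
          change 𝒱.f k ≫ u.left = (𝒱.f k ≫ gU) ≫ (σ k : Over.mk U.ι ⟶ A.X).left
          rw [hσ k, Category.assoc])
      rw [heq]
      exact A.memKOfL_comp hL _ _ ((A.mem_kOfL_iff hL hε _).1 (σ k).2)
    choose vk hvk using hloc
    let vkL : ∀ k, 𝒱.X k ⟶ Z.left := fun k => (vk k).left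
    have hvkL : ∀ k, vkL k ≫ i.left = 𝒱.f k ≫ u.left := fun k => by
      change (vk k ≫ i).left = _
      rw [hvk k]; rfl
    have hcompat : ∀ k k', pullback.fst (𝒱.f k) (𝒱.f k') ≫ vkL k = pullback.snd (𝒱.f k) (𝒱.f k') ≫ vkL k' := by
      intro k k'
      rw [← cancel_mono i.left, Category.assoc, Category.assoc, hvkL, hvkL, pullback.condition_assoc]
    let vL : T.left ⟶ Z.left := Scheme.Cover.glueMorphisms 𝒱 vkL hcompat
    have hvL : ∀ k, 𝒱.f k ≫ vL = vkL k := fun k => Scheme.Cover.ι_glueMorphisms 𝒱 _ hcompat k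
    have hvLi : vL ≫ i.left = u.left :=
      Scheme.Cover.hom_ext 𝒱 _ _ fun k => by rw [← Category.assoc, hvL, hvkL]
    have hvLS : vL ≫ Z.hom = T.hom := by
      rw [← Over.w i, ← Category.assoc, hvLi]; exact Over.w u
    exact (hZ T u).1 ⟨Over.homMk vL hvLS, Over.OverMorphism.ext (by change vL ≫ i.left = u.left; exact hvLi)⟩

end AbelianSchemeOver

end Literature.AlgebraicGeometry.AbelianSchemes

end
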